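import Summits.HodgeConjecture.CorCM.DecicWeil23PairHodgeOfMarkman
import Summits.HodgeConjecture.CorCM.OcticWeil13PairFamilyHodgeOfMarkman
import HarnessLib

/-!
# COR-CM — two `(2,3)`-types over one decic CM field: the FAMILY form — the Hodge conjecture for `E^a × ∏_j A_j` for ANY finite
# family of CM abelian fivefolds over `K` whose CM types take (at most) TWO distinct values of `k`-signature `(2,3)`, GIVEN ONLY
# Markman's hyperbolic-sixfold theorem (and `3`-transitivity)

Cell `pub-hodgecm2` (COR-CM), seat b30 gen 22 (2026-08-22); count-neutral own lane DECIC-WEIL-23PAIR — family form of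
`DecicWeil23Pair.hodgeConjectureFor_biproduct_comp_vec_of_markmanD` (the pattern of gen 21's `OcticWeil13PairFamilyHodgeOfMarkman`).
Theorems only; no definition, no `sorry`; displayed named fact: `Markman2025_weilClasses_algebraic_hyperbolicSixfold`.

* `avDominatedBy_of_cmType_eq` — realisations of EQUAL CM types dominate each other (Shimura's uniqueness of the isogeny class of
  a CM type, `Shimura1998_Thm2_Cor_holds`);
* **`hodgeConjectureFor_of_avDominatedBy_family_of_markmanD`** — `A_j ⊨ (K; Φ_j)` (`j < n`) CM abelian fivefolds over one decic
  CM field `K ⊇ i(k)`, each `Φ_j` EQUAL to `Φ_{j₁}` or to `Φ_{j₂}`, these two being DISTINCT and of `k`-signature `(2,3)` — e.g.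
  Galois conjugates `σB` of one CM fivefold, with any CM structures and polarisations, falling into two types — `Aut(ℂ)`
  `3`-transitive on the embeddings over `τ`, `E ⊨ (k; Ψ ∋ τ)`: every `C` dominated by `E^a × ⨁_j A_j` satisfies the Hodge
  conjecture (each `A_j` is isogenous to `A_{j₁}` or `A_{j₂}`; `Domination.AVDominatedBy.biproduct_map`,
  `AndreRiemann.avDominatedBy_prod_of_biproduct`).
HONEST FRAMING: conditional on the displayed Markman binder; nothing here asserts `HC_CM`.
[cite: Markman2025SecantWeil, Thm 1.5.1] [cite: Shimura1998, §6.1 Thm. 2 Cor.] [cite: MumfordAV1970, §19]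

## References
* [Markman2025SecantWeil] E. Markman, arXiv:2502.03415, Thm 1.5.1.  [Shimura1998] G. Shimura, *Abelian varieties with complex
  multiplication and modular functions*, §6.1 Theorem 2, Corollary.  [MumfordAV1970] D. Mumford, *Abelian Varieties*, §19.
-/

noncomputable section

open CategoryTheory CategoryTheory.Limits NumberField

namespace Summit.HodgeConjecture.CorCM.DecicWeil23Pair

open Literature.AlgebraicGeometry Literature.AlgebraicGeometry.Motives Literature.AlgebraicGeometry.HodgeTheory
open Literature.AlgebraicGeometry.ComplexMultiplication (IsCMTypeRealisation Shimura1998_Thm2_Cor_holds)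
open Literature.AlgebraicTopology.SingularHomology
open Summit.HodgeConjecture.CorCM.Domination (AVDominatedBy)
open Summit.HodgeConjecture.CorCM.AndreRiemann (sumFam avDominatedBy_prod_of_biproduct avDominatedBy_biproduct_reindex)

open scoped Classical

section Family

variable {K : Type} [Field K] [NumberField K] [IsCMField K] {k : Type} [Field k] [NumberField k] [IsCMField k]

/-- **Realisations of the same CM type dominate each other** (they are isogenous: Shimura's uniqueness of the isogeny class of
a CM type). [cite: Shimura1998, §6.1 Thm. 2 Cor.] -/
theorem avDominatedBy_of_cmType_eq {Φ₁ Φ₂ : CMType K} (h : Φ₁ = Φ₂)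
    {A₁ : AbelianVariety ℂ} {ι₁ : 𝓞 K →+* End A₁} {θ₁ : K →+* Module.End ℂ (complexBetti A₁.X 1)}
    (hA₁ : IsCMTypeRealisation Φ₁ A₁ ι₁ θ₁)
    {A₂ : AbelianVariety ℂ} {ι₂ : 𝓞 K →+* End A₂} {θ₂ : K →+* Module.End ℂ (complexBetti A₂.X 1)}
    (hA₂ : IsCMTypeRealisation Φ₂ A₂ ι₂ θ₂) : AVDominatedBy A₁ A₂ := by
  subst h
  obtain ⟨g, hg, -⟩ := Shimura1998_Thm2_Cor_holds K Φ₁ A₁ ι₁ θ₁ A₂ ι₂ θ₂ hA₁ hA₂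
  exact AVDominatedBy.of_isIsogeny_hom hg (AVDominatedBy.refl A₂)

variable {n : ℕ} {Φ : Fin n → CMType K} {A : Fin n → AbelianVariety ℂ} {ι : ∀ j, 𝓞 K →+* End (A j)}
  {θ : ∀ j, K →+* Module.End ℂ (complexBetti (A j).X 1)}
  {Ψ : CMType k} {E : AbelianVariety ℂ} {ιE : 𝓞 k →+* End E} {θE : k →+* Module.End ℂ (complexBetti E.X 1)}

/-- **THE FAMILY FORM.**  `K ⊇ i(k)` ANY CM field of degree `10` over the imaginary quadratic `k`, `τ : k → ℂ` with `Aut(ℂ)`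
`3`-transitive on the five embeddings of `K` over `τ` (`h3T`); `A_j ⊨ (K; Φ_j)` (`j < n`) CM abelian fivefolds, each `Φ_j` equal to
`Φ_{j₁}` or to `Φ_{j₂}` (`hpos`), where `Φ_{j₁} ≠ Φ_{j₂}` (`hne`) have two members over `τ` each (`k`-signature `(2,3)`); `E ⊨ (k; Ψ ∋ τ)`.
Then every `C` dominated by `E^a × ⨁_j A_j` satisfies the Hodge conjecture, GIVEN ONLY Markman's hyperbolic-sixfold theorem.
[cite: Markman2025SecantWeil, Thm 1.5.1] [cite: Shimura1998, §6.1 Thm. 2 Cor.] [cite: MumfordAV1970, §19] -/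
theorem hodgeConjectureFor_of_avDominatedBy_family_of_markmanD
    (hM6 : Markman2025_weilClasses_algebraic_hyperbolicSixfold)
    (h10 : Module.finrank ℚ K = 10) (h2 : Module.finrank ℚ k = 2) (i : k →+* K)
    (hA : ∀ j, IsCMTypeRealisation (Φ j) (A j) (ι j) (θ j)) {τ : k →+* ℂ} (j₁ j₂ : Fin n)
    (h23₁ : (Finset.univ.filter fun s : K →+* ℂ => s.comp i = τ ∧ s ∈ (Φ j₁).1).card = 2)
    (h23₂ : (Finset.univ.filter fun s : K →+* ℂ => s.comp i = τ ∧ s ∈ (Φ j₂).1).card = 2) (hne : Φ j₁ ≠ Φ j₂)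
    (hpos : ∀ j, Φ j = Φ j₁ ∨ Φ j = Φ j₂)
    (h3T : ∀ x y : Fin 3 ↪ {s : K →+* ℂ // s.comp i = τ}, ∃ ρ : ℂ ≃+* ℂ, ∀ l : Fin 3, (ρ : ℂ →+* ℂ).comp (x l).1 = (y l).1)
    (hE : IsCMTypeRealisation Ψ E ιE θE) (hτΨ : τ ∈ Ψ.1) (a : ℕ)
    {C : AbelianVariety ℂ} (hC : AVDominatedBy C ((⨁ fun _ : Fin a => E).prod (⨁ A))) :
    HodgeConjectureFor C.dim C.X := by
  -- each `A_j` is dominated by `A_{j₁}` or `A_{j₂}`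
  let Bv : Fin 2 → AbelianVariety ℂ := ![A j₁, A j₂]
  have hdomB : ∀ j, ∃ m : Fin 2, AVDominatedBy (A j) (Bv m) := by
    intro j
    rcases hpos j with h | h
    · exact ⟨0, avDominatedBy_of_cmType_eq h (hA j) (hA j₁)⟩
    · exact ⟨1, avDominatedBy_of_cmType_eq h (hA j) (hA j₂)⟩
  choose m hm using hdomB
  -- domination of `E^a × ⨁ A` by a product of copies of `E, A j₁, A j₂`
  let Y : Fin 3 → AbelianVariety ℂ := ![E, A j₁, A j₂]
  have hYsucc : ∀ m : Fin 2, Y m.succ = Bv m := fun m => rfl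
  have h₁ : AVDominatedBy (⨁ fun _ : Fin a => E) (⨁ fun _ : Fin a => Y 0) :=
    AVDominatedBy.biproduct_map fun _ => AVDominatedBy.refl E
  have h₂ : AVDominatedBy (⨁ A) (⨁ fun j => Y (m j).succ) :=
    AVDominatedBy.biproduct_map fun j => by rw [hYsucc]; exact hm j
  have h₁₂' := avDominatedBy_prod_of_biproduct h₁ h₂
  let κ' : Fin a ⊕ Fin n → Fin 3 := Sum.elim (fun _ => 0) fun j => (m j).succ
  have hfam : sumFam (fun _ : Fin a => Y 0) (fun j => Y (m j).succ) = Y ∘ κ' := funext fun x => by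
    cases x <;> rfl
  rw [hfam] at h₁₂'
  have hdom := avDominatedBy_biproduct_reindex finSumFinEquiv.symm h₁₂'
  exact Domination.hodgeConjectureFor_of_avDominatedBy
    (hodgeConjectureFor_biproduct_comp_vec_of_markmanD hM6 h10 h2 i (hA j₁) (hA j₂) hE hτΨ h23₁ h23₂ hne h3T
      (κ' ∘ finSumFinEquiv.symm)) (hC.trans hdom)

/-- **In particular: the Hodge conjecture for `∏_j A_j` itself** (no curve factor), and so for every product of members of the
two isogeny classes — e.g. `B₁ × B₂`, the carrier of the TENFOLD Weil classes of `B₁ × B̄₂` — GIVEN ONLY Markman's sixfold theorem.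
[cite: Markman2025SecantWeil, Thm 1.5.1] [cite: MumfordAV1970, §19] -/
theorem hodgeConjectureFor_biproduct_family_of_markmanD
    (hM6 : Markman2025_weilClasses_algebraic_hyperbolicSixfold)
    (h10 : Module.finrank ℚ K = 10) (h2 : Module.finrank ℚ k = 2) (i : k →+* K)
    (hA : ∀ j, IsCMTypeRealisation (Φ j) (A j) (ι j) (θ j)) {τ : k →+* ℂ} (j₁ j₂ : Fin n)
    (h23₁ : (Finset.univ.filter fun s : K →+* ℂ => s.comp i = τ ∧ s ∈ (Φ j₁).1).card = 2)
    (h23₂ : (Finset.univ.filter fun s : K →+* ℂ => s.comp i = τ ∧ s ∈ (Φ j₂).1).card = 2) (hne : Φ j₁ ≠ Φ j₂)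
    (hpos : ∀ j, Φ j = Φ j₁ ∨ Φ j = Φ j₂)
    (h3T : ∀ x y : Fin 3 ↪ {s : K →+* ℂ // s.comp i = τ}, ∃ ρ : ℂ ≃+* ℂ, ∀ l : Fin 3, (ρ : ℂ →+* ℂ).comp (x l).1 = (y l).1)
    (hE : IsCMTypeRealisation Ψ E ιE θE) (hτΨ : τ ∈ Ψ.1) :
    HodgeConjectureFor (⨁ A).dim (⨁ A).X :=
  hodgeConjectureFor_of_avDominatedBy_family_of_markmanD hM6 h10 h2 i hA j₁ j₂ h23₁ h23₂ hne hpos h3T hE hτΨ 0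
    (C := ⨁ A) ⟨AbelianVariety.prodLift 0 (𝟙 _), AbelianVariety.snd _ _, 1, one_ne_zero, by
      rw [AbelianVariety.prodLift_snd, one_smul]⟩

end Family

end Summit.HodgeConjecture.CorCM.DecicWeil23Pair

end
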